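import Literature.MathematicalPhysics.QuantumFieldTheory.Balaban1983to89.B9Eq319QprimeLipschitzTwoBackgrounds
import Literature.MathematicalPhysics.QuantumFieldTheory.Balaban1983to89.B9Eq326OperatorAssembly
import Literature.MathematicalPhysics.QuantumFieldTheory.Balaban1983to89.B9Eq373DerivativeRemainderL2

/-!
# `Balaban1983to89.B9Eq3101ConjugationLetters` — T. Bałaban, *Propagators for lattice gauge theories in a background field*, Commun. Math.
# Phys. **99** (1985) 389–434 [Balaban1985BackgroundPropagators] (3.49) p. 399 with (3.101)–(3.103) p. 414: **THE COMBES–THOMAS CONJUGATION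
# LETTERS OF THE COVARIANT DERIVATIVE `D_U` (3.3) AND OF THE BLOCK AVERAGING `Q′(U)` (3.19) ARE `η`-FREE, `U`-FREE AND VOLUME-FREE** —
# `‖e^{κχ}D_U(e^{−κχ}f) − D_Uf‖ ≤ 2|κ|ℓ·M_T·√d·‖f‖` (`c = η⁻¹`, bond increments `≤ ℓη`) and `Σ_y‖e^{κχ′(y)}Q′(U)(e^{−κχ}λ)(y) − Q′(U)λ(y)‖² ≤
# (2|κ|ℓ′M_A)²·L^{−d}·Σ_x‖λ x‖²` — route R2′ STEP B8′ S-P5(b), input (I4): THE LATTICE PORT of the NE9 crux-ideation seat's abstract kernel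

statement-level skeleton of published theorems with citation tags; proofs where landed; nothing here is a claim about the Yang–Mills mass gap

CITATION HEADER (lean-in-tree rule).  Audit cell `pub-balaban`, sub-cell `t4`, BINDER row NE9; filed by NE9 formalisation-swarm leaf prover 05
(`b2b-balaban-t4-ne9-formalise-leaf-05`, gen 72) as the PORT, on the tree's own lattice objects, of the NE9 crux-ideation seat's abstract finite-graph
kernel `t4/ideate/NE9/lens1-NE9ConjugatedLettersEtaFree.lean` v1.1 (t4-ne9-idea-1 gen 88, sha16 6f63eddbc7a13ed9; scratch, Mathlib only, never
proposed — CREDIT: every statement and proof idea below is that kernel's; new here is only the dress: the periodic lattice `TSite d P` with its bonds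
`Bond d P = TSite × Fin d` (`bpos b = b.1`, `btgt b = b.1 + e_{b.2}`), the tree's covariant derivative `B9Eq33CovDerivVector.covDeriv` ∕
`B11Eq103H1Complex.covDerivL2K` on the weighted `L²` carriers `SiteL2K → BondL2K`, and the tree's one-step block averaging
`B9Eq319QprimeTorus.QprimeLin` (blocks `blockOf`, weight `L^{−d}`, contour transports `B9Eq323Ker.pathTr`), for `t4/ROUTES-NE9.md` v13.25∕v13.26 §L1.2
R2′ STEP B8′ S-P5(b) input (I4) (v13.25 ADDENDUM (i): «PORT (S, not mine under FREEZE) … nobody's INTENT today»).  Source READ in the held text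
[Balaban1985BackgroundPropagators]: p. 399 (3.49) (the kernels `D^η P(U) D^{η*}` «have regular kernels» with the factor «exp(−δ d(y,y′))» — obtained in
print from the random-walk expansions; the CONJUGATION `e^{κχ}(·)e^{−κχ}` is the Combes–Thomas device the route substitutes for them), p. 414
(3.101)–(3.103) (*«[Q_j, h] = S_j(δh)»* — the commutators of the averaging operators and of the derivative with a slowly varying function are «of the
order O(M⁻¹)» «on a proper scale»: the ADDITIVE form of the letters below); the method is that of J.-M. Combes and L. Thomas, Commun. Math. Phys. **34**
(1973) 251–270 [CombesThomas1973], cited for context only.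

WHY (route R2′ STEP B8′ «Tier P by discrete IMS localisation», knot S-P5(b) «unit-scale `L²`-locality of `DP`»).  The knot conjugates the constituents
of print's projection formula (3.25) by `S = e^{κχ}` for a cutoff `χ` varying on the scale `M` (`M∕η` lattice units) and needs, for EACH constituent
`X ∈ {D_U, D_U*, Q̃′(U), Q̃′(U)†}`, a bound `‖S X S⁻¹ − X‖ ≤ s_X·|κ|` with `s_X` carrying NO lattice spacing `η`, NO window in the background `U` and
NO volume (ROUTES-NE9 v13.21 (iii)(b); v13.25 ADDENDUM (i) «(I4)»; v13.26 ADDENDUM (ii) «DICTIONARY FOR THE S-P5(b) PORTER»: `δ± ≤ s_A|κ|`).  For `D_U`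
the `η⁻¹` of the difference quotient EATS the `η` of the increment of `χ` over one bond; for `Q′` a block has bounded PHYSICAL diameter at or below the
point `ηL = 1`, so there is no `η` to cancel; in both, the background enters ONLY through a bound on the transporters' operator norms.

WHAT IS PROVED (sorry-free; proof lane — no `def`, no `Prop` placeholder; [folklore] finite sums and `‖e^z − 1‖ ≤ 2‖z‖`; nothing of [B9] asserted).
* §1 `norm_exp_sub_one_le_of_abs_le` (`|Δ| ≤ θ`, `‖κ‖θ ≤ 1 ⇒ ‖e^{κΔ} − 1‖ ≤ 2‖κ‖θ`), **`inv_eta_mul_norm_exp_sub_one_le`** (THE `η`-CANCELLATION: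
  `|Δ| ≤ ℓη`, `‖κ‖ℓη ≤ 1 ⇒ η⁻¹‖e^{κΔ} − 1‖ ≤ 2‖κ‖ℓ`), `exp_mul_exp_neg_eq_one`, `exp_mul_exp_neg_eq_exp_sub`.
* §2 THE BOND LETTER at function level, for the tree's `covDeriv c R` on `TSite d P` with ANY scalar `c` and transporters `‖R(b)v‖ ≤ M_T‖v‖`:
  `conj_covDeriv_sub_apply` (general weights `σρ = 1`: `σ(b₋)·D(ρf)(b) − Df(b) = (c(σ(b₋)ρ(b₊) − 1))·R(b)f(b₊)` — the `f(b₋)` term cancels EXACTLY),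
  `conjExp_covDeriv_sub_apply`, **`norm_conjExp_covDeriv_sub_apply_le`** (`|χ(b₋) − χ(b₊)| ≤ θ`, `‖κ‖θ ≤ 1 ⇒ ≤ 2‖c‖‖κ‖θM_T‖f(b₊)‖`),
  **`norm_conjExp_covDeriv_sub_apply_le_etaFree`** (`c = η⁻¹`, `θ = ℓη`: `≤ 2‖κ‖ℓM_T‖f(b₊)‖` — NO `η`), **`sum_norm_sq_conjExp_covDeriv_sub_le`**
  (`Σ_b ‖·‖² ≤ (2‖c‖‖κ‖θM_T)²·d·Σ_x ‖f x‖²`, every site being the tip of EXACTLY `d` bonds — leaf-04's `B9Eq373DerivativeRemainderL2.sum_bond_btgt` BY NAME).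
* §3 THE BOND LETTER on the weighted `L²` carriers (`B11Eq103H1Complex.covDerivL2K`, equal site∕bond weight `c₀`): **`norm_conjExp_covDerivL2K_sub_le`**
  (`‖e^{κχ}·D(e^{−κχ}f) − Df‖ ≤ 2‖c‖‖κ‖θM_T√d·‖f‖`) and THE `η`-FREE READING **`norm_conjExp_covDerivL2K_sub_le_etaFree`** (`c = η⁻¹`, `θ = ℓη`:
  `≤ 2‖κ‖ℓM_T√d·‖f‖` — no `η`, no volume, the background only through `M_T`).
* §4 THE BLOCK-AVERAGING LETTER for the tree's `QprimeLin L m Rb` ((3.19) on the torus `TSite d (L·m)`, blocks `blockOf`, weight `L^{−d}`; the contour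
  transports `R(Γ_{y,x}) = pathTr …` bounded by a DISPLAYED `M_A`): `pathTr_stepTransport_smul`, `QprimeLin_apply_eq_sum`, `conj_QprimeLin_sub_apply`
  (identity), **`norm_conjExp_QprimeLin_sub_apply_le`** (`|χ′(y) − χ(x)| ≤ ℓ′` for `x ∈ B(y)`, `‖κ‖ℓ′ ≤ 1` ⇒ `≤ 2‖κ‖ℓ′M_A·L^{−d}·Σ_{B(y)}‖λ x‖`),
  **`sum_norm_sq_conjExp_QprimeLin_sub_le`** (`Σ_y ‖·‖² ≤ (2‖κ‖ℓ′M_A)²·L^{−d}·Σ_x ‖λ x‖²`), the chain's weighted reading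
  **`weighted_sum_norm_sq_conjExp_QprimeLin_sub_le`** (`c₁ = L^d·c₀`, the point `ηL = 1`: `c₁Σ_y ‖·‖² ≤ (2‖κ‖ℓ′M_A)²·c₀Σ_x ‖λ x‖²` — no `η`, no `L`,
  no volume) and the transport letter DISCHARGED from `ε`-close bond transporters, `norm_pathTr_contour_le` (`M_A = (1 + ε)^{d(L−1)}`).
HONEST SCOPE.  Letters only: NO decay statement ((3.49) itself), NO commutator ∕ Cauchy step in `κ`, NO projection (those are S-P5(b)'s (I1)–(I3) and the
porter's (3.25) assembly); the adjoint letters for `D*`, `Q̃′†` follow by `‖A†‖ = ‖A‖` at `−κ̄` (words, not typed here); the transport bounds `M_T`, `M_A`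
and the cutoff's bond ∕ block increments `θ` (`= ℓη`), `ℓ′` are DISPLAYED (at the chain's `adTransportW φ U` with `U(b) ∈ U1`: `M_T = M_φM_φ′`; `M_A` by
`norm_pathTr_contour_le`); ONE input of one sub-step of a route step, NOT NE9 (cell pub-balaban: NE9 NOT PRINTED ∕ NOT PROVED; «NE9 ⇐ the named
binders»; spine PROVED 0∕9; rung (B)+1 on a finite T⁴ — NOT infinite volume, NOT mass gap, NOT Clay; HONEST DEPENDENCY: continuum YM on T⁴ ⇐ BetaPertH ∧
nine spine estimates (0/9 proved); BetaPertH ⇐ (D1) ∧ (D4) ∧ CAP+tail; G-an2-4 gates asym, D1 and NE2/3/4).  NEW file; nothing modified.  Net new unproved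
facts: 0.
-/

noncomputable section

open scoped InnerProductSpace
open Finset

namespace Literature.MathematicalPhysics.QuantumFieldTheory.Balaban1983to89.B9Eq3101ConjugationLetters

open B4Sect5Torus (TSite)
open B9SectCLatticeCarrier (Bond bpos btgt shift unshift)
open B9Eq33CovDerivVector (covDeriv covDeriv_apply)
open B9Eq373DerivativeRemainderL2 (sum_bond_btgt)
open B9Eq311L2Pairing (WL2)
open B11Eq103H1Complex (SiteL2K BondL2K covDerivL2K)
open B9Eq323Ker (pathTr avgQ)
open B9Eq319QprimeTorus (fineP centre blockCoord contour stepTransport weight Qprime QprimeLin QprimeLin_apply length_contour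
  pathTr_restrictScalars_smul)
open B9Eq319QprimeLipschitz (norm_stepTransport_sub_le length_contour_le blockMean_norm_sq_le sum_blockOf_sum)
open B9Eq319QprimeLipschitzTwoBackgrounds (norm_pathTr_cons_le)
open B5Eq172FlatCoercivity (card_blockOf)

/-! ## §1 The `η`-cancellation -/

section Scalar

/-- `|Δ| ≤ θ` and the window `‖κ‖θ ≤ 1` give `‖e^{κΔ} − 1‖ ≤ 2‖κ‖θ` (Mathlib's `‖e^z − 1‖ ≤ 2‖z‖` on `‖z‖ ≤ 1`). [folklore]
[cite: Balaban1985BackgroundPropagators, (3.101)–(3.103) p.414] -/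
theorem norm_exp_sub_one_le_of_abs_le {θ Δ : ℝ} {κ : ℂ} (hΔ : |Δ| ≤ θ) (hwin : ‖κ‖ * θ ≤ 1) :
    ‖Complex.exp (κ * (Δ : ℂ)) - 1‖ ≤ 2 * ‖κ‖ * θ := by
  have hz : ‖κ * (Δ : ℂ)‖ ≤ ‖κ‖ * θ := by
    rw [norm_mul, Complex.norm_real, Real.norm_eq_abs]
    exact mul_le_mul_of_nonneg_left hΔ (norm_nonneg κ)
  calc ‖Complex.exp (κ * (Δ : ℂ)) - 1‖ ≤ 2 * ‖κ * (Δ : ℂ)‖ := Complex.norm_exp_sub_one_le (hz.trans hwin)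
    _ ≤ 2 * (‖κ‖ * θ) := by linarith
    _ = 2 * ‖κ‖ * θ := by ring

/-- **THE `η`-CANCELLATION.** If the increment satisfies `|Δ| ≤ ℓ·η` (one bond of a cutoff with physical Lipschitz modulus `ℓ`) and the window
`‖κ‖·ℓ·η ≤ 1` holds, then `η⁻¹·‖e^{κΔ} − 1‖ ≤ 2‖κ‖ℓ`: the `η⁻¹` of the difference quotient cancels the `η` of the increment. [folklore]
[cite: Balaban1985BackgroundPropagators, (3.101)–(3.103) p.414] -/
theorem inv_eta_mul_norm_exp_sub_one_le {η ℓ Δ : ℝ} {κ : ℂ} (hη : 0 < η) (hΔ : |Δ| ≤ ℓ * η) (hwin : ‖κ‖ * ℓ * η ≤ 1) :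
    η⁻¹ * ‖Complex.exp (κ * (Δ : ℂ)) - 1‖ ≤ 2 * ‖κ‖ * ℓ := by
  have hwin' : ‖κ‖ * (ℓ * η) ≤ 1 := by simpa [mul_assoc] using hwin
  have h1 : ‖Complex.exp (κ * (Δ : ℂ)) - 1‖ ≤ 2 * ‖κ‖ * (ℓ * η) := norm_exp_sub_one_le_of_abs_le hΔ hwin'
  calc η⁻¹ * ‖Complex.exp (κ * (Δ : ℂ)) - 1‖ ≤ η⁻¹ * (2 * ‖κ‖ * (ℓ * η)) := mul_le_mul_of_nonneg_left h1 (inv_nonneg.mpr hη.le)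
    _ = 2 * ‖κ‖ * ℓ * (η⁻¹ * η) := by ring
    _ = 2 * ‖κ‖ * ℓ := by rw [inv_mul_cancel₀ hη.ne', mul_one]

/-- The exponential weights `σ = e^{κχ}`, `ρ = e^{−κχ}` satisfy `σ(x)ρ(x) = 1` … [folklore] [cite: Balaban1985BackgroundPropagators, (3.49) p.399] -/
theorem exp_mul_exp_neg_eq_one {S : Type*} (κ : ℂ) (χ : S → ℝ) (x : S) :
    Complex.exp (κ * (χ x : ℂ)) * Complex.exp (-(κ * (χ x : ℂ))) = 1 := by
  rw [← Complex.exp_add, add_neg_cancel, Complex.exp_zero]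

/-- … and `σ(y)ρ(x) = e^{κ(χ′ y − χ x)}` (two cutoffs: `χ′` where the outside weight is read, `χ` inside). [folklore]
[cite: Balaban1985BackgroundPropagators, (3.49) p.399] -/
theorem exp_mul_exp_neg_eq_exp_sub {S S' : Type*} (κ : ℂ) (χ : S → ℝ) (χ' : S' → ℝ) (y : S') (x : S) :
    Complex.exp (κ * (χ' y : ℂ)) * Complex.exp (-(κ * (χ x : ℂ))) = Complex.exp (κ * ((χ' y - χ x : ℝ) : ℂ)) := by
  rw [← Complex.exp_add]
  push_cast
  ring_nf

end Scalar

/-! ## §2 The bond letter at function level: the tree's `covDeriv c R` on the periodic lattice -/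

section Bond

variable {d : ℕ} {Pd : Fin d → ℕ} {V : Type*} [NormedAddCommGroup V] [NormedSpace ℂ V]

/-- **IDENTITY (general weights).** If `σ x · ρ x = 1` for all sites `x`, the `f(b₋)` term cancels exactly and
`σ(b₋)·(D(ρf))(b) − (Df)(b) = (c·(σ(b₋)ρ(b₊) − 1))·R(b)f(b₊)` for the tree's covariant derivative `(Df)(b) = c·(R(b)f(b₊) − f(b₋))`, ANY scalar `c`,
ANY `ℂ`-linear transporters. [folklore] [cite: Balaban1985BackgroundPropagators, (3.3) pp.390–391, (3.101)–(3.103) p.414] -/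
theorem conj_covDeriv_sub_apply {σ ρ : TSite d Pd → ℂ} (hσρ : ∀ x, σ x * ρ x = 1) (c : ℂ) (R : Bond d Pd → V →ₗ[ℂ] V) (f : TSite d Pd → V)
    (b : Bond d Pd) :
    σ (bpos b) • covDeriv c R (fun x => ρ x • f x) b - covDeriv c R f b = (c * (σ (bpos b) * ρ (btgt b) - 1)) • R b (f (btgt b)) := by
  have h1 := hσρ (bpos b)
  simp only [covDeriv_apply, map_smul, smul_sub, smul_smul]
  match_scalars <;> first | ring1 | linear_combination c * h1 | linear_combination (-c) * h1

/-- **IDENTITY (exponential weights):** `(e^{κχ} D e^{−κχ} − D)f (b) = c·(e^{κ(χ(b₋) − χ(b₊))} − 1)·R(b)f(b₊)`. [folklore]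
[cite: Balaban1985BackgroundPropagators, (3.49) p.399, (3.101)–(3.103) p.414] -/
theorem conjExp_covDeriv_sub_apply (κ : ℂ) (χ : TSite d Pd → ℝ) (c : ℂ) (R : Bond d Pd → V →ₗ[ℂ] V) (f : TSite d Pd → V) (b : Bond d Pd) :
    Complex.exp (κ * (χ (bpos b) : ℂ)) • covDeriv c R (fun x => Complex.exp (-(κ * (χ x : ℂ))) • f x) b - covDeriv c R f b =
      (c * (Complex.exp (κ * ((χ (bpos b) - χ (btgt b) : ℝ) : ℂ)) - 1)) • R b (f (btgt b)) := by
  rw [conj_covDeriv_sub_apply (exp_mul_exp_neg_eq_one κ χ) c R f b, exp_mul_exp_neg_eq_exp_sub]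

/-- **POINTWISE BOUND — ANY `c`, the background only through `M_T`.** With `|χ(b₋) − χ(b₊)| ≤ θ` on every bond, the window `‖κ‖θ ≤ 1` and
transporters `‖R(b)v‖ ≤ M_T‖v‖`: `‖(e^{κχ} D e^{−κχ} − D)f (b)‖ ≤ 2‖c‖‖κ‖θ·M_T·‖f(b₊)‖`. [folklore]
[cite: Balaban1985BackgroundPropagators, (3.49) p.399, (3.101)–(3.103) p.414] -/
theorem norm_conjExp_covDeriv_sub_apply_le {θ MT : ℝ} {R : Bond d Pd → V →ₗ[ℂ] V} (hR : ∀ b v, ‖R b v‖ ≤ MT * ‖v‖) {κ : ℂ}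
    {χ : TSite d Pd → ℝ} (hχ : ∀ b : Bond d Pd, |χ (bpos b) - χ (btgt b)| ≤ θ) (hwin : ‖κ‖ * θ ≤ 1) (c : ℂ) (f : TSite d Pd → V)
    (b : Bond d Pd) :
    ‖Complex.exp (κ * (χ (bpos b) : ℂ)) • covDeriv c R (fun x => Complex.exp (-(κ * (χ x : ℂ))) • f x) b - covDeriv c R f b‖ ≤
      2 * ‖c‖ * ‖κ‖ * θ * MT * ‖f (btgt b)‖ := by
  rw [conjExp_covDeriv_sub_apply, norm_smul, norm_mul]
  have h1 : ‖Complex.exp (κ * ((χ (bpos b) - χ (btgt b) : ℝ) : ℂ)) - 1‖ ≤ 2 * ‖κ‖ * θ := norm_exp_sub_one_le_of_abs_le (hχ b) hwin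
  have h2 : ‖R b (f (btgt b))‖ ≤ MT * ‖f (btgt b)‖ := hR b _
  have h0 : 0 ≤ 2 * ‖κ‖ * θ := le_trans (norm_nonneg _) h1
  calc ‖c‖ * ‖Complex.exp (κ * ((χ (bpos b) - χ (btgt b) : ℝ) : ℂ)) - 1‖ * ‖R b (f (btgt b))‖
      ≤ ‖c‖ * (2 * ‖κ‖ * θ) * (MT * ‖f (btgt b)‖) :=
        mul_le_mul (mul_le_mul_of_nonneg_left h1 (norm_nonneg c)) h2 (norm_nonneg _) (mul_nonneg (norm_nonneg c) h0)
    _ = 2 * ‖c‖ * ‖κ‖ * θ * MT * ‖f (btgt b)‖ := by ring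

/-- **THE `η`-FREE POINTWISE READING:** at print's scalar `c = η⁻¹` and a cutoff with bond increments `|χ(b₋) − χ(b₊)| ≤ ℓη` (physical Lipschitz
modulus `ℓ`), in the window `‖κ‖ℓη ≤ 1`: `‖(e^{κχ} D e^{−κχ} − D)f (b)‖ ≤ 2‖κ‖ℓ·M_T·‖f(b₊)‖` — NO `η`. [folklore]
[cite: Balaban1985BackgroundPropagators, (3.49) p.399, (3.101)–(3.103) p.414] -/
theorem norm_conjExp_covDeriv_sub_apply_le_etaFree {η ℓ MT : ℝ} (hη : 0 < η) {R : Bond d Pd → V →ₗ[ℂ] V}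
    (hR : ∀ b v, ‖R b v‖ ≤ MT * ‖v‖) {κ : ℂ} {χ : TSite d Pd → ℝ} (hχ : ∀ b : Bond d Pd, |χ (bpos b) - χ (btgt b)| ≤ ℓ * η)
    (hwin : ‖κ‖ * ℓ * η ≤ 1) (f : TSite d Pd → V) (b : Bond d Pd) :
    ‖Complex.exp (κ * (χ (bpos b) : ℂ)) • covDeriv ((η : ℂ))⁻¹ R (fun x => Complex.exp (-(κ * (χ x : ℂ))) • f x) b -
        covDeriv ((η : ℂ))⁻¹ R f b‖ ≤ 2 * ‖κ‖ * ℓ * MT * ‖f (btgt b)‖ := by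
  have hwin' : ‖κ‖ * (ℓ * η) ≤ 1 := by simpa [mul_assoc] using hwin
  refine (norm_conjExp_covDeriv_sub_apply_le hR hχ hwin' _ f b).trans_eq ?_
  rw [norm_inv, Complex.norm_real, Real.norm_eq_abs, abs_of_pos hη]
  field_simp

/-- **`ℓ²` BOUND at function level:** `Σ_b ‖(e^{κχ} D e^{−κχ} − D)f (b)‖² ≤ (2‖c‖‖κ‖θM_T)²·d·Σ_x ‖f x‖²`. [folklore]
[cite: Balaban1985BackgroundPropagators, (3.49) p.399, (3.101)–(3.103) p.414] -/
theorem sum_norm_sq_conjExp_covDeriv_sub_le {θ MT : ℝ} {R : Bond d Pd → V →ₗ[ℂ] V} (hR : ∀ b v, ‖R b v‖ ≤ MT * ‖v‖) {κ : ℂ}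
    {χ : TSite d Pd → ℝ} (hχ : ∀ b : Bond d Pd, |χ (bpos b) - χ (btgt b)| ≤ θ) (hwin : ‖κ‖ * θ ≤ 1) (c : ℂ) (f : TSite d Pd → V) :
    ∑ b : Bond d Pd, ‖Complex.exp (κ * (χ (bpos b) : ℂ)) • covDeriv c R (fun x => Complex.exp (-(κ * (χ x : ℂ))) • f x) b - covDeriv c R f b‖ ^ 2
      ≤ (2 * ‖c‖ * ‖κ‖ * θ * MT) ^ 2 * d * ∑ x, ‖f x‖ ^ 2 := by
  calc ∑ b : Bond d Pd, ‖Complex.exp (κ * (χ (bpos b) : ℂ)) • covDeriv c R (fun x => Complex.exp (-(κ * (χ x : ℂ))) • f x) b -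
          covDeriv c R f b‖ ^ 2
      ≤ ∑ b : Bond d Pd, (2 * ‖c‖ * ‖κ‖ * θ * MT) ^ 2 * ‖f (btgt b)‖ ^ 2 := by
        refine sum_le_sum fun b _ => ?_
        have h := norm_conjExp_covDeriv_sub_apply_le hR hχ hwin c f b
        calc _ ≤ (2 * ‖c‖ * ‖κ‖ * θ * MT * ‖f (btgt b)‖) ^ 2 := pow_le_pow_left₀ (norm_nonneg _) h 2
          _ = (2 * ‖c‖ * ‖κ‖ * θ * MT) ^ 2 * ‖f (btgt b)‖ ^ 2 := by ring
    _ = (2 * ‖c‖ * ‖κ‖ * θ * MT) ^ 2 * ∑ b : Bond d Pd, ‖f (btgt b)‖ ^ 2 := by rw [mul_sum]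
    _ = (2 * ‖c‖ * ‖κ‖ * θ * MT) ^ 2 * d * ∑ x, ‖f x‖ ^ 2 := by
        rw [sum_bond_btgt (fun x => ‖f x‖ ^ 2)]; ring

end Bond

/-! ## §3 The bond letter on the weighted `L²` carriers `SiteL2K → BondL2K` -/

section L2

variable {d : ℕ} {Pd : Fin d → ℕ} {V : Type*} [NormedAddCommGroup V] [InnerProductSpace ℂ V] {c₀ : ℝ} [Fact (0 < c₀)]

/-- **THE BOND LETTER IN `L²` — ANY `c`, the background only through `M_T`, NO VOLUME:** for the tree's `covDerivL2K ℂ c₀ c R` (equal weight `c₀`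
on sites and bonds), `‖e^{κχ}·D(e^{−κχ}f) − Df‖ ≤ 2‖c‖‖κ‖θ·M_T·√d·‖f‖` whenever `|χ(b₋) − χ(b₊)| ≤ θ` on every bond, `0 ≤ θ`, `0 ≤ M_T` and
`‖κ‖θ ≤ 1` (the conjugated field and the outside weight are written through the carrier's identification `WL2.equiv` with the functions). [folklore]
[cite: Balaban1985BackgroundPropagators, (3.49) p.399, (3.101)–(3.103) p.414, (3.11) p.392] -/
theorem norm_conjExp_covDerivL2K_sub_le {θ MT : ℝ} (hθ : 0 ≤ θ) (hMT : 0 ≤ MT) {R : Bond d Pd → V →ₗ[ℂ] V} (hR : ∀ b v, ‖R b v‖ ≤ MT * ‖v‖)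
    {κ : ℂ} {χ : TSite d Pd → ℝ} (hχ : ∀ b : Bond d Pd, |χ (bpos b) - χ (btgt b)| ≤ θ) (hwin : ‖κ‖ * θ ≤ 1) (c : ℂ)
    (f : SiteL2K ℂ d Pd c₀ V) :
    ‖(WL2.equiv ℂ (fun _ : Bond d Pd => c₀) V).symm
          (fun b => Complex.exp (κ * (χ (bpos b) : ℂ)) •
            WL2.equiv ℂ (fun _ : Bond d Pd => c₀) V
              (covDerivL2K ℂ c₀ c R ((WL2.equiv ℂ (fun _ : TSite d Pd => c₀) V).symm
                fun x => Complex.exp (-(κ * (χ x : ℂ))) • WL2.equiv ℂ (fun _ : TSite d Pd => c₀) V f x)) b) -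
        covDerivL2K ℂ c₀ c R f‖ ≤ 2 * ‖c‖ * ‖κ‖ * θ * MT * Real.sqrt d * ‖f‖ := by
  set K : ℝ := 2 * ‖c‖ * ‖κ‖ * θ * MT with hK
  have hK0 : 0 ≤ K := by positivity
  have hc₀ : 0 < c₀ := Fact.out
  set g : TSite d Pd → V := WL2.equiv ℂ (fun _ : TSite d Pd => c₀) V f with hg
  have hsum := sum_norm_sq_conjExp_covDeriv_sub_le hR hχ hwin c g
  have hsq : ‖(WL2.equiv ℂ (fun _ : Bond d Pd => c₀) V).symm
          (fun b => Complex.exp (κ * (χ (bpos b) : ℂ)) •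
            WL2.equiv ℂ (fun _ : Bond d Pd => c₀) V
              (covDerivL2K ℂ c₀ c R ((WL2.equiv ℂ (fun _ : TSite d Pd => c₀) V).symm
                fun x => Complex.exp (-(κ * (χ x : ℂ))) • WL2.equiv ℂ (fun _ : TSite d Pd => c₀) V f x)) b) -
        covDerivL2K ℂ c₀ c R f‖ ^ 2 ≤ (K * Real.sqrt d * ‖f‖) ^ 2 := by
    rw [WL2.norm_sq, mul_pow, mul_pow, Real.sq_sqrt (Nat.cast_nonneg d), WL2.norm_sq f]
    have e : ∀ b : Bond d Pd,
        WL2.equiv ℂ (fun _ : Bond d Pd => c₀) V ((WL2.equiv ℂ (fun _ : Bond d Pd => c₀) V).symm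
          (fun b => Complex.exp (κ * (χ (bpos b) : ℂ)) •
            WL2.equiv ℂ (fun _ : Bond d Pd => c₀) V
              (covDerivL2K ℂ c₀ c R ((WL2.equiv ℂ (fun _ : TSite d Pd => c₀) V).symm
                fun x => Complex.exp (-(κ * (χ x : ℂ))) • WL2.equiv ℂ (fun _ : TSite d Pd => c₀) V f x)) b) -
          covDerivL2K ℂ c₀ c R f) b =
        Complex.exp (κ * (χ (bpos b) : ℂ)) • covDeriv c R (fun x => Complex.exp (-(κ * (χ x : ℂ))) • g x) b - covDeriv c R g b :=
      fun b => rfl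
    simp only [e]
    rw [← mul_sum, ← mul_sum]
    calc c₀ * ∑ b : Bond d Pd, ‖Complex.exp (κ * (χ (bpos b) : ℂ)) • covDeriv c R (fun x => Complex.exp (-(κ * (χ x : ℂ))) • g x) b -
            covDeriv c R g b‖ ^ 2
        ≤ c₀ * (K ^ 2 * d * ∑ x, ‖g x‖ ^ 2) := mul_le_mul_of_nonneg_left hsum hc₀.le
      _ = K ^ 2 * d * (c₀ * ∑ x, ‖g x‖ ^ 2) := by ring
  have hR0 : 0 ≤ K * Real.sqrt d * ‖f‖ := by positivity
  calc _ ≤ K * Real.sqrt d * ‖f‖ := (pow_le_pow_iff_left₀ (norm_nonneg _) hR0 two_ne_zero).1 hsq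
    _ = 2 * ‖c‖ * ‖κ‖ * θ * MT * Real.sqrt d * ‖f‖ := by rw [hK]

/-- **THE `η`-FREE READING IN `L²` (the (I4) letter `s_D`):** at print's scalar `c = η⁻¹` and a cutoff with bond increments `≤ ℓη`, in the window
`‖κ‖ℓη ≤ 1`: `‖e^{κχ}·D(e^{−κχ}f) − Df‖ ≤ 2‖κ‖ℓ·M_T·√d·‖f‖` — NO `η`, NO volume, the background only through `M_T`. [folklore]
[cite: Balaban1985BackgroundPropagators, (3.49) p.399, (3.101)–(3.103) p.414, (3.11) p.392] -/
theorem norm_conjExp_covDerivL2K_sub_le_etaFree {η ℓ MT : ℝ} (hη : 0 < η) (hℓ : 0 ≤ ℓ) (hMT : 0 ≤ MT) {R : Bond d Pd → V →ₗ[ℂ] V}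
    (hR : ∀ b v, ‖R b v‖ ≤ MT * ‖v‖) {κ : ℂ} {χ : TSite d Pd → ℝ} (hχ : ∀ b : Bond d Pd, |χ (bpos b) - χ (btgt b)| ≤ ℓ * η)
    (hwin : ‖κ‖ * ℓ * η ≤ 1) (f : SiteL2K ℂ d Pd c₀ V) :
    ‖(WL2.equiv ℂ (fun _ : Bond d Pd => c₀) V).symm
          (fun b => Complex.exp (κ * (χ (bpos b) : ℂ)) •
            WL2.equiv ℂ (fun _ : Bond d Pd => c₀) V
              (covDerivL2K ℂ c₀ ((η : ℂ))⁻¹ R ((WL2.equiv ℂ (fun _ : TSite d Pd => c₀) V).symm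
                fun x => Complex.exp (-(κ * (χ x : ℂ))) • WL2.equiv ℂ (fun _ : TSite d Pd => c₀) V f x)) b) -
        covDerivL2K ℂ c₀ ((η : ℂ))⁻¹ R f‖ ≤ 2 * ‖κ‖ * ℓ * MT * Real.sqrt d * ‖f‖ := by
  have hwin' : ‖κ‖ * (ℓ * η) ≤ 1 := by simpa [mul_assoc] using hwin
  refine (norm_conjExp_covDerivL2K_sub_le (by positivity) hMT hR hχ hwin' _ f).trans_eq ?_
  rw [norm_inv, Complex.norm_real, Real.norm_eq_abs, abs_of_pos hη]
  field_simp

end L2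

/-! ## §4 The block-averaging letter: the tree's one-step `Q′` (3.19) on the torus -/

section Block

variable {d : ℕ} (L : ℕ) [NeZero L] (m : Fin d → ℕ) {V : Type*} [NormedAddCommGroup V] [NormedSpace ℂ V]

omit [NeZero L] in
/-- The contour transport `R(Γ)` built from `ℂ`-linear bond transporters commutes with complex scalars. [folklore]
[cite: Balaban1985BackgroundPropagators, (3.19) p.393] -/
theorem pathTr_stepTransport_smul (Rb : Bond d (fineP L m) → V →ₗ[ℂ] V) (a : ℂ) (p : List (TSite d (fineP L m))) (v : V) :
    pathTr (stepTransport L m fun b => (Rb b).restrictScalars ℝ) p (a • v) = a • pathTr (stepTransport L m fun b => (Rb b).restrictScalars ℝ) p v := by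
  have hτ : (stepTransport L m fun b => (Rb b).restrictScalars ℝ) =
      fun x x' => (if h : ∃ κ : Fin d, x' = shift κ x then Rb (x, h.choose) else LinearMap.id).restrictScalars ℝ := by
    funext x x'
    unfold stepTransport
    split_ifs <;> rfl
  rw [hτ, pathTr_restrictScalars_smul]

/-- (3.19) unfolded at a coarse site: `(Q′λ)(y) = Σ_{x∈B(y)} L^{−d}·R(Γ_{y,x})λ(x)`. [cite: Balaban1985BackgroundPropagators, (3.19) p.393] -/
theorem QprimeLin_apply_eq_sum (Rb : Bond d (fineP L m) → V →ₗ[ℂ] V) (l : TSite d (fineP L m) → V) (y : TSite d m) :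
    QprimeLin L m Rb l y = ∑ x ∈ B9Eq319QprimeTorus.blockOf L m y,
      ((L : ℝ) ^ d)⁻¹ • pathTr (stepTransport L m fun b => (Rb b).restrictScalars ℝ) (centre L m y :: contour L m x) (l x) := by
  rw [QprimeLin_apply, Qprime, avgQ]
  rfl

/-- **IDENTITY (general weights) for `Q′`:** with an outside weight `σ′` on the coarse sites and an inside weight `ρ` on the fine sites,
`σ′(y)·Q′(ρλ)(y) − Q′λ(y) = Σ_{x∈B(y)} L^{−d}·(σ′(y)ρ(x) − 1)·R(Γ_{y,x})λ(x)`. [folklore] [cite: Balaban1985BackgroundPropagators, (3.19) p.393, (3.101)–(3.103) p.414] -/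
theorem conj_QprimeLin_sub_apply (σ' : TSite d m → ℂ) (ρ : TSite d (fineP L m) → ℂ) (Rb : Bond d (fineP L m) → V →ₗ[ℂ] V)
    (l : TSite d (fineP L m) → V) (y : TSite d m) :
    σ' y • QprimeLin L m Rb (fun x => ρ x • l x) y - QprimeLin L m Rb l y = ∑ x ∈ B9Eq319QprimeTorus.blockOf L m y,
      ((L : ℝ) ^ d)⁻¹ • ((σ' y * ρ x - 1) •
        pathTr (stepTransport L m fun b => (Rb b).restrictScalars ℝ) (centre L m y :: contour L m x) (l x)) := by
  rw [QprimeLin_apply_eq_sum, QprimeLin_apply_eq_sum, smul_sum, ← sum_sub_distrib]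
  refine sum_congr rfl fun x _ => ?_
  rw [pathTr_stepTransport_smul, smul_comm (σ' y), smul_smul, ← smul_sub, sub_smul, one_smul]

/-- **POINTWISE BOUND for `Q′` — no `η` at all, the background only through `M_A`.** With `|χ′(y) − χ(x)| ≤ ℓ′` for `x ∈ B(y)` (a block has bounded
PHYSICAL diameter at or below the point `ηL = 1`), the window `‖κ‖ℓ′ ≤ 1` and contour transports `‖R(Γ_{y,x})v‖ ≤ M_A‖v‖`:
`‖e^{κχ′(y)}·Q′(e^{−κχ}λ)(y) − Q′λ(y)‖ ≤ 2‖κ‖ℓ′M_A·L^{−d}·Σ_{x∈B(y)}‖λ x‖`. [folklore] [cite: Balaban1985BackgroundPropagators, (3.19) p.393, (3.101)–(3.103) p.414] -/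
theorem norm_conjExp_QprimeLin_sub_apply_le {ℓ' MA : ℝ} (Rb : Bond d (fineP L m) → V →ₗ[ℂ] V)
    (hA : ∀ (y : TSite d m), ∀ x ∈ B9Eq319QprimeTorus.blockOf L m y, ∀ v : V,
      ‖pathTr (stepTransport L m fun b => (Rb b).restrictScalars ℝ) (centre L m y :: contour L m x) v‖ ≤ MA * ‖v‖)
    {κ : ℂ} {χ : TSite d (fineP L m) → ℝ} {χ' : TSite d m → ℝ} (hχ : ∀ (y : TSite d m), ∀ x ∈ B9Eq319QprimeTorus.blockOf L m y, |χ' y - χ x| ≤ ℓ')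
    (hwin : ‖κ‖ * ℓ' ≤ 1) (l : TSite d (fineP L m) → V) (y : TSite d m) :
    ‖Complex.exp (κ * (χ' y : ℂ)) • QprimeLin L m Rb (fun x => Complex.exp (-(κ * (χ x : ℂ))) • l x) y - QprimeLin L m Rb l y‖ ≤
      2 * ‖κ‖ * ℓ' * MA * (((L : ℝ) ^ d)⁻¹ * ∑ x ∈ B9Eq319QprimeTorus.blockOf L m y, ‖l x‖) := by
  have hw : 0 ≤ ((L : ℝ) ^ d)⁻¹ := by positivity
  have hid := conj_QprimeLin_sub_apply L m (fun y => Complex.exp (κ * (χ' y : ℂ))) (fun x => Complex.exp (-(κ * (χ x : ℂ)))) Rb l y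
  beta_reduce at hid
  rw [hid, mul_sum, mul_sum]
  refine (norm_sum_le _ _).trans (sum_le_sum fun x hx => ?_)
  rw [norm_smul, norm_inv, norm_pow, Real.norm_natCast, norm_smul, exp_mul_exp_neg_eq_exp_sub]
  have h1 : ‖Complex.exp (κ * ((χ' y - χ x : ℝ) : ℂ)) - 1‖ ≤ 2 * ‖κ‖ * ℓ' := norm_exp_sub_one_le_of_abs_le (hχ y x hx) hwin
  have h2 := hA y x hx (l x)
  have h0 : 0 ≤ 2 * ‖κ‖ * ℓ' := le_trans (norm_nonneg _) h1
  calc ((L : ℝ) ^ d)⁻¹ * (‖Complex.exp (κ * ((χ' y - χ x : ℝ) : ℂ)) - 1‖ *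
          ‖pathTr (stepTransport L m fun b => (Rb b).restrictScalars ℝ) (centre L m y :: contour L m x) (l x)‖)
      ≤ ((L : ℝ) ^ d)⁻¹ * ((2 * ‖κ‖ * ℓ') * (MA * ‖l x‖)) :=
        mul_le_mul_of_nonneg_left (mul_le_mul h1 h2 (norm_nonneg _) h0) hw
    _ = 2 * ‖κ‖ * ℓ' * MA * (((L : ℝ) ^ d)⁻¹ * ‖l x‖) := by ring

/-- **`ℓ²` BOUND for `Q′` — VOLUME-FREE:** `Σ_y ‖e^{κχ′(y)}·Q′(e^{−κχ}λ)(y) − Q′λ(y)‖² ≤ (2‖κ‖ℓ′M_A)²·L^{−d}·Σ_x ‖λ x‖²` (Jensen on each block, then the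
blocks partition the fine lattice). [folklore] [cite: Balaban1985BackgroundPropagators, (3.19) p.393, (3.101)–(3.103) p.414, (3.11) p.392] -/
theorem sum_norm_sq_conjExp_QprimeLin_sub_le {ℓ' MA : ℝ} (Rb : Bond d (fineP L m) → V →ₗ[ℂ] V)
    (hA : ∀ (y : TSite d m), ∀ x ∈ B9Eq319QprimeTorus.blockOf L m y, ∀ v : V,
      ‖pathTr (stepTransport L m fun b => (Rb b).restrictScalars ℝ) (centre L m y :: contour L m x) v‖ ≤ MA * ‖v‖)
    {κ : ℂ} {χ : TSite d (fineP L m) → ℝ} {χ' : TSite d m → ℝ} (hχ : ∀ (y : TSite d m), ∀ x ∈ B9Eq319QprimeTorus.blockOf L m y, |χ' y - χ x| ≤ ℓ')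
    (hwin : ‖κ‖ * ℓ' ≤ 1) (l : TSite d (fineP L m) → V) :
    ∑ y, ‖Complex.exp (κ * (χ' y : ℂ)) • QprimeLin L m Rb (fun x => Complex.exp (-(κ * (χ x : ℂ))) • l x) y - QprimeLin L m Rb l y‖ ^ 2 ≤
      (2 * ‖κ‖ * ℓ' * MA) ^ 2 * (((L : ℝ) ^ d)⁻¹ * ∑ x, ‖l x‖ ^ 2) := by
  calc ∑ y, ‖Complex.exp (κ * (χ' y : ℂ)) • QprimeLin L m Rb (fun x => Complex.exp (-(κ * (χ x : ℂ))) • l x) y - QprimeLin L m Rb l y‖ ^ 2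
      ≤ ∑ y, (2 * ‖κ‖ * ℓ' * MA * (((L : ℝ) ^ d)⁻¹ * ∑ x ∈ B9Eq319QprimeTorus.blockOf L m y, ‖l x‖)) ^ 2 :=
        sum_le_sum fun y _ => pow_le_pow_left₀ (norm_nonneg _) (norm_conjExp_QprimeLin_sub_apply_le L m Rb hA hχ hwin l y) 2
    _ ≤ ∑ y, (2 * ‖κ‖ * ℓ' * MA) ^ 2 * (((L : ℝ) ^ d)⁻¹ * ∑ x ∈ B9Eq319QprimeTorus.blockOf L m y, ‖l x‖ ^ 2) :=
        sum_le_sum fun y _ => by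
          rw [mul_pow]; exact mul_le_mul_of_nonneg_left (blockMean_norm_sq_le L m l y) (sq_nonneg _)
    _ = (2 * ‖κ‖ * ℓ' * MA) ^ 2 * (((L : ℝ) ^ d)⁻¹ * ∑ x, ‖l x‖ ^ 2) := by
        rw [← mul_sum, ← mul_sum, sum_blockOf_sum]

/-- **THE CHAIN's WEIGHTED READING (the (I4) letter `s_{Q′}`):** with the site weight `c₀` of the fine `L²` carrier and the coarse weight `c₁ = L^d·c₀`
(the point `ηL = 1` of route R2′), `c₁·Σ_y ‖e^{κχ′(y)}·Q′(e^{−κχ}λ)(y) − Q′λ(y)‖² ≤ (2‖κ‖ℓ′M_A)²·(c₀·Σ_x ‖λ x‖²)` — no `η`, no `L`, no volume, the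
background only through `M_A`. [folklore] [cite: Balaban1985BackgroundPropagators, (3.19) p.393, (3.101)–(3.103) p.414, (3.11) p.392] -/
theorem weighted_sum_norm_sq_conjExp_QprimeLin_sub_le {ℓ' MA c₀ c₁ : ℝ} (hc₀ : 0 ≤ c₀) (hc : c₁ = (L : ℝ) ^ d * c₀)
    (Rb : Bond d (fineP L m) → V →ₗ[ℂ] V)
    (hA : ∀ (y : TSite d m), ∀ x ∈ B9Eq319QprimeTorus.blockOf L m y, ∀ v : V,
      ‖pathTr (stepTransport L m fun b => (Rb b).restrictScalars ℝ) (centre L m y :: contour L m x) v‖ ≤ MA * ‖v‖)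
    {κ : ℂ} {χ : TSite d (fineP L m) → ℝ} {χ' : TSite d m → ℝ} (hχ : ∀ (y : TSite d m), ∀ x ∈ B9Eq319QprimeTorus.blockOf L m y, |χ' y - χ x| ≤ ℓ')
    (hwin : ‖κ‖ * ℓ' ≤ 1) (l : TSite d (fineP L m) → V) :
    c₁ * ∑ y, ‖Complex.exp (κ * (χ' y : ℂ)) • QprimeLin L m Rb (fun x => Complex.exp (-(κ * (χ x : ℂ))) • l x) y - QprimeLin L m Rb l y‖ ^ 2 ≤
      (2 * ‖κ‖ * ℓ' * MA) ^ 2 * (c₀ * ∑ x, ‖l x‖ ^ 2) := by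
  have h := sum_norm_sq_conjExp_QprimeLin_sub_le L m Rb hA hχ hwin l
  have hL : (0 : ℝ) < (L : ℝ) ^ d := by
    have : (0 : ℝ) < L := by exact_mod_cast Nat.pos_of_ne_zero (NeZero.ne L)
    positivity
  have hc₁ : 0 ≤ c₁ := by rw [hc]; positivity
  have hcw : c₁ * ((L : ℝ) ^ d)⁻¹ = c₀ := by rw [hc]; field_simp
  calc c₁ * ∑ y, ‖Complex.exp (κ * (χ' y : ℂ)) • QprimeLin L m Rb (fun x => Complex.exp (-(κ * (χ x : ℂ))) • l x) y - QprimeLin L m Rb l y‖ ^ 2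
      ≤ c₁ * ((2 * ‖κ‖ * ℓ' * MA) ^ 2 * (((L : ℝ) ^ d)⁻¹ * ∑ x, ‖l x‖ ^ 2)) := mul_le_mul_of_nonneg_left h hc₁
    _ = (2 * ‖κ‖ * ℓ' * MA) ^ 2 * ((c₁ * ((L : ℝ) ^ d)⁻¹) * ∑ x, ‖l x‖ ^ 2) := by ring
    _ = (2 * ‖κ‖ * ℓ' * MA) ^ 2 * (c₀ * ∑ x, ‖l x‖ ^ 2) := by rw [hcw]

/-- **THE TRANSPORT LETTER `M_A` DISCHARGED from `ε`-close bond transporters:** if `‖R(b)v − v‖ ≤ ε‖v‖` on every bond then along every block contour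
(at most `d(L−1)` bonds) `‖R(Γ_{y,x})v‖ ≤ (1 + ε)^{d(L−1)}·‖v‖`. [folklore] [cite: Balaban1985BackgroundPropagators, (3.19) p.393, (3.65) p.403] -/
theorem norm_pathTr_contour_le (Rb : Bond d (fineP L m) → V →ₗ[ℂ] V) {ε : ℝ} (hε : 0 ≤ ε) (hR : ∀ b v, ‖Rb b v - v‖ ≤ ε * ‖v‖)
    (y : TSite d m) (x : TSite d (fineP L m)) (v : V) :
    ‖pathTr (stepTransport L m fun b => (Rb b).restrictScalars ℝ) (centre L m y :: contour L m x) v‖ ≤ (1 + ε) ^ (d * (L - 1)) * ‖v‖ := by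
  have h1 := norm_pathTr_cons_le hε (norm_stepTransport_sub_le L m Rb hε hR) (contour L m x) (centre L m y) v
  exact h1.trans (mul_le_mul_of_nonneg_right (pow_le_pow_right₀ (by linarith) (length_contour_le L m x)) (norm_nonneg _))

end Block

end Literature.MathematicalPhysics.QuantumFieldTheory.Balaban1983to89.B9Eq3101ConjugationLetters

end
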